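import Summits.BirchSwinnertonDyer.Rank1Residual.Supersingular.X6RankZeroLeafTarget
import Summits.BirchSwinnertonDyer.Rank1Residual.Supersingular.KobayashiConverseReal
import Summits.BirchSwinnertonDyer.BirchSwinnertonDyer.Theorems.PrintX6KobayashiUpperHalf
import Literature.NumberTheory.EllipticCurves.Wuthrich2014.ThreeAdicImageSupersingularProofs
import HarnessLib

/-!
# Leaf `ClassX6 ∧ r_an = 0`: the RESIDUAL of the leaf over the refereed inputs, by name
# (cell `bsd-print-x6`, typer seat `ty2`, tranche 3 of the discharge interface; THEOREMS ONLY; closes nothing)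

HONEST FRAMING (run/shared/lean/pub/bsd-print-x6/README.md; PRINT tier D-0131 (2); PARTITION currency D-0054: leaf A6 =
`ClassX6 ∧ r_an = 0`, rung W-ALL/6 `Summit.BirchSwinnertonDyer.WAllCornerX6r0`). Tranches 1–2
(`X6RankZeroLeafHypotheses.lean`, `X6RankZeroLeafTarget.lean`) discharge every printed hypothesis of every cited
theorem from the leaf predicate and give the assembly of route `PrintX6` in kernel form. Since then the route's
upper half `UpperHalfX6` (stmt-BirchSwinnertonDyer-20301) was PROVED from the refereed inputs (prover p2,
`Summit.BirchSwinnertonDyer.BirchSwinnertonDyer.Theorems.X6.missingUpperBoundAt_rankZero_of_thm41`: Kobayashi 2003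
Thm. 4.1 (b) with the `p`-adic tower onto — a tree theorem on X6 — + Thm. 1.2 + B. D. Kim 2013 Cor. 3.15 + the
period units + modularity + GZK), so Wuthrich 2014 Prop. 21 is no longer needed anywhere on the leaf. THIS FILE
re-reads the leaf's residual through that upper half, over the EIGHT refereed named facts the route consumes
(`h12` Kobayashi Thm. 1.2, `h41` Thm. 4.1, `hKim` Kim Cor. 3.15, `h5`/`h3` the Néron-vs-`Ω⁺_f` period units,
`hmodP`/`hmod` modularity, `hGZK` Gross–Zagier–Kolyvagin; Wuthrich Lemma 20 and Pollack's `L_p^±` are tree THEOREMS: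
`Wuthrich2014.lemma20_surjective_threeAdic_of_semistable_holds`, `pollack_exists_plusMinusPAdicLFunction_holds`):

* §1 pair level — at an X6 ∧ {r_an = 0} pair with odd `p`: `BSD(E,p)` ⟺ Kobayashi's main conjecture for
  `(E, p, ε)` ⟺ its Eisenstein half `KobayashiLowerDivisibility W p ε`, for EACH sign
  (`X6RankZero.bsdp_iff_kobayashiMainConjecture`, `X6RankZero.bsdp_iff_kobayashiLowerDivisibility`,
  `X6RankZero.kobayashiLowerDivisibility_iff_mainConjecture`) — the Wuthrich-free, Pollack-free, Lemma-20-free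
  twins of `X6.bsdp_iff_*_of_analyticRank_eq_zero` (`KobayashiEquivalenceRankZero.lean`, cell bsd-ssimc);
* §2 class level — over the eight inputs the rung `WAllCornerX6r0` IS Kobayashi's main conjecture on the
  rank-zero slice of X6, in its strongest form (both signs, full equality) as well as its weakest (some sign,
  Eisenstein half only): `X6RankZero.wallCornerX6r0_iff_forall_kobayashiMainConjecture`,
  `X6RankZero.wallCornerX6r0_iff_forall_exists_kobayashiLowerDivisibility`; and the rung from the BODY of cell
  bsd-ssimc's crux `KobayashiLowerHalfSemistable` (route `SignedLowerHalves`, stmt-BirchSwinnertonDyer-19000,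
  rank-free) with the eight inputs only (`X6RankZero.wallCornerX6r0_of_inputs_of_forall_kobayashiLowerDivisibility`)
  — the route header's clause «PrintX6 is mooted if SignedLowerHalves closes 19000», Wuthrich-free.

So, modulo refereed print consumed by name, the deficit of the leaf is EXACTLY the `r_an = 0` slice of K3's crux
19000, and on that slice the one-sign Eisenstein half and the full ± main conjecture coincide. This file is
deliberately route-independent (no `Theses` import): the by-name links to the route ITEMS (`EisensteinHalfFiveLe`,
`EisensteinHalfAtThree`, `PublishedInputsX6`) and to K3's item `def` are one-liners over it and belong under
`Summits/…/Theorems/` (prover seats; turnkey `PrintX6ResidualLinks.lean` on the cell INBOX).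

Every theorem here is bookkeeping over tree theorems (0 `def`, 0 named fact, debt 0); nothing about any particular
curve is asserted; BSD is not proved by any of this; beyond-print theorem: NO; PARTITION: 0 cells move.

References: `Theorems/PrintX6KobayashiUpperHalf.lean` (p532875), `Supersingular/KobayashiConverseReal.lean`,
`Supersingular/KobayashiEquivalenceRankZero.lean`, `WAll/Target.lean` (row 6); [Kobayashi2003] Thm. 1.2 (p. 2),
Thm. 4.1 (p. 8), (3.6) (p. 7), Conjecture (p. 2); [BDKim2013] Cor. 3.15 (p. 199); [GreenbergVatsal2000] Rem. 3.4;
[Wuthrich2014] Lemma 20 (p. 399); [Pollack2003] Thm. 5.6; [Miller2011LMS] Def. 1.1; [SilvermanATAEC1994] II.6.4.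
-/

set_option autoImplicit false

noncomputable section

open scoped Classical

open WeierstrassCurve Literature.NumberTheory.EllipticCurves
  Literature.NumberTheory.EllipticCurves.ModularForms
  Literature.NumberTheory.EllipticCurves.Rank1Residual
  Literature.NumberTheory.EllipticCurves.Rank1Residual.Typed
  Literature.NumberTheory.EllipticCurves.Kobayashi2003

namespace Summit.BirchSwinnertonDyer.Rank1Residual.Supersingular

/-! ### §1 Pair level: `BSD(E,p)` ⟺ Kobayashi's main conjecture ⟺ its Eisenstein half, over the eight inputs -/

section Pair

variable (W : WeierstrassCurve ℚ) [W.IsElliptic] [W.IsGloballyMinimal] (p : ℕ) [Fact p.Prime]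

/-- **X6 ∧ {r_an = 0}, odd `p`: the UPPER half from the eight inputs** — prover p2's
`Theorems.X6.missingUpperBoundAt_rankZero_of_thm41` re-exported in this namespace's binder order (Kobayashi Thm. 4.1
integral clause, tower onto by `ClassX6.imageContainsSL2`; Thm. 1.2; Kim Cor. 3.15; period units; modularity; GZK).
[cite: Kobayashi2003, Thm. 4.1 (p. 8) and Thm. 1.2 (p. 2)] [cite: BDKim2013, Cor. 3.15 (p. 199)]
[cite: GreenbergVatsal2000, §3, Remark 3.4] [cite: Miller2011LMS, Def. 1.1] -/
theorem X6RankZero.missingUpperBoundAt_of_inputs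
    (h12 : thm12_signedSelmerDual_finite_torsion) (h41 : thm41_signedCharIdeal_divisibility)
    (hKim : BDKim2013.cor315_signedCharValue_rankZero)
    (h5 : realPeriodRat_eq_unit_mul_plusPeriod) (h3 : realPeriodRat_eq_unit_mul_plusPeriod_three)
    (hmodP : nonempty_modularParametrizationData) (hmod : hasEntireLFunction_rat)
    (hGZK : rank_eq_analyticRank_of_analyticRank_le_one)
    (hp : p ≠ 2) (hX : ClassX6 W p) (h0 : W.analyticRank = 0) : MissingUpperBoundAt W p :=
  Summit.BirchSwinnertonDyer.BirchSwinnertonDyer.Theorems.X6.missingUpperBoundAt_rankZero_of_thm41 W p h41 h12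
    hKim h5 h3 hmodP hmod hGZK hp hX h0

/-- **X6 ∧ {r_an = 0}, odd `p`: `BSD(E,p)` from the eight inputs and the Eisenstein half for ONE sign** —
lower half by `missingLowerBoundAt_of_kobayashiLowerDivisibility` (Thm. 1.2, Kim Cor. 3.15, Pollack proved,
modularity, GZK; `a_p = 0`, `E[p]` irreducible from `ClassX6`), upper half by
`X6RankZero.missingUpperBoundAt_of_inputs`, then `bsdp_of_missingPPartAt`. The Wuthrich-free twin of
`X6.bsdp_of_kobayashiLowerDivisibility_of_analyticRank_eq_zero`. CONDITIONAL on `hε`; closes nothing.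
[cite: Kobayashi2003, Thm. 1.2 (p. 2), Thm. 4.1 (p. 8), (3.6) (p. 7)] [cite: BDKim2013, Cor. 3.15 (p. 199)]
[cite: Pollack2003, Thm. 5.6] [cite: Miller2011LMS, §1 and Def. 1.1] -/
theorem X6RankZero.bsdp_of_inputs_of_kobayashiLowerDivisibility
    (h12 : thm12_signedSelmerDual_finite_torsion) (h41 : thm41_signedCharIdeal_divisibility)
    (hKim : BDKim2013.cor315_signedCharValue_rankZero)
    (h5 : realPeriodRat_eq_unit_mul_plusPeriod) (h3 : realPeriodRat_eq_unit_mul_plusPeriod_three)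
    (hmodP : nonempty_modularParametrizationData) (hmod : hasEntireLFunction_rat)
    (hGZK : rank_eq_analyticRank_of_analyticRank_le_one)
    (hp : p ≠ 2) (hX : ClassX6 W p) (h0 : W.analyticRank = 0) {ε : ℤˣ}
    (hε : KobayashiLowerDivisibility W p ε) : BSDp W p :=
  bsdp_of_missingPPartAt W p hGZK (by omega)
    (missingPPartAt_of_lower_of_upper W p
      (missingLowerBoundAt_of_kobayashiLowerDivisibility W p h12 hKim
        pollack_exists_plusMinusPAdicLFunction_holds hmodP hGZK hp hX.1.1
        (ClassX6.frobeniusTrace_eq_zero W p hp hX) (ClassX6.irr W p hp hX)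
        ((W.analyticRank_eq_zero_iff_holds (hmod W)).1 h0) hε)
      (X6RankZero.missingUpperBoundAt_of_inputs W p h12 h41 hKim h5 h3 hmodP hmod hGZK hp hX h0))

/-- **X6 ∧ {r_an = 0}, odd `p`: `BSD(E,p)` ⟹ Kobayashi's main conjecture for `(E, p, ε)`, BOTH signs, from the
eight inputs** — the tree's rank-zero converse `X6.kobayashiMainConjecture_of_bsdp_of_analyticRank_eq_zero`
(b2b-bsdres prover B) with its Wuthrich-Lemma-20 binder fed by the tree THEOREM
`Wuthrich2014.lemma20_surjective_threeAdic_of_semistable_holds`. CONDITIONAL on `hB`; closes nothing.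
[cite: Kobayashi2003, Thm. 1.2 (p. 2), Thm. 4.1 (p. 8), (3.6) (p. 7) and Conjecture (p. 2)]
[cite: BDKim2013, Cor. 3.15 (p. 199)] [cite: GreenbergVatsal2000, §3, Remark 3.4] [cite: Wuthrich2014, Lemma 20 (p. 399)]
[cite: Miller2011LMS, Def. 1.1] -/
theorem X6RankZero.kobayashiMainConjecture_of_inputs_of_bsdp
    (h12 : thm12_signedSelmerDual_finite_torsion) (h41 : thm41_signedCharIdeal_divisibility)
    (hKim : BDKim2013.cor315_signedCharValue_rankZero)
    (h5 : realPeriodRat_eq_unit_mul_plusPeriod) (h3 : realPeriodRat_eq_unit_mul_plusPeriod_three)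
    (hmod : hasEntireLFunction_rat) (hGZK : rank_eq_analyticRank_of_analyticRank_le_one)
    (hp : p ≠ 2) (hX : ClassX6 W p) (h0 : W.analyticRank = 0) (hB : BSDp W p) (ε : ℤˣ) :
    KobayashiMainConjecture W p ε :=
  X6.kobayashiMainConjecture_of_bsdp_of_analyticRank_eq_zero W p h12 h41 hKim h5 h3
    Wuthrich2014.lemma20_surjective_threeAdic_of_semistable_holds hGZK hmod hp hX h0 hB ε

/-- **X6 ∧ {r_an = 0}, odd `p`: `BSD(E,p)` ⟺ Kobayashi's main conjecture for `(E, p, ε)`, each sign, over the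
eight inputs.** The Wuthrich-free twin of `X6.bsdp_iff_kobayashiMainConjecture_of_analyticRank_eq_zero`. Per pair; a
statement about hypotheses; closes nothing. [cite: Kobayashi2003, Thm. 1.2 (p. 2), Thm. 4.1 (p. 8) and Conjecture (p. 2)]
[cite: BDKim2013, Cor. 3.15 (p. 199)] [cite: Miller2011LMS, §1 and Def. 1.1] -/
theorem X6RankZero.bsdp_iff_kobayashiMainConjecture
    (h12 : thm12_signedSelmerDual_finite_torsion) (h41 : thm41_signedCharIdeal_divisibility)
    (hKim : BDKim2013.cor315_signedCharValue_rankZero)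
    (h5 : realPeriodRat_eq_unit_mul_plusPeriod) (h3 : realPeriodRat_eq_unit_mul_plusPeriod_three)
    (hmodP : nonempty_modularParametrizationData) (hmod : hasEntireLFunction_rat)
    (hGZK : rank_eq_analyticRank_of_analyticRank_le_one)
    (hp : p ≠ 2) (hX : ClassX6 W p) (h0 : W.analyticRank = 0) (ε : ℤˣ) :
    BSDp W p ↔ KobayashiMainConjecture W p ε :=
  ⟨fun hB ↦ X6RankZero.kobayashiMainConjecture_of_inputs_of_bsdp W p h12 h41 hKim h5 h3 hmod hGZK hp hX h0 hB ε,
    fun hMC ↦ X6RankZero.bsdp_of_inputs_of_kobayashiLowerDivisibility W p h12 h41 hKim h5 h3 hmodP hmod hGZK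
      hp hX h0 (kobayashiLowerDivisibility_of_mainConjecture hMC)⟩

/-- **X6 ∧ {r_an = 0}, odd `p`: `BSD(E,p)` ⟺ the Eisenstein half `KobayashiLowerDivisibility W p ε`, each sign,
over the eight inputs** — the leaf's typed rank-zero residue. The Wuthrich-free twin of
`X6.bsdp_iff_kobayashiLowerDivisibility_of_analyticRank_eq_zero`. Per pair; closes nothing.
[cite: Kobayashi2003, Thm. 1.2 (p. 2), Thm. 4.1 (p. 8) and Conjecture (p. 2)] [cite: BDKim2013, Cor. 3.15 (p. 199)]
[cite: Miller2011LMS, §1 and Def. 1.1] -/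
theorem X6RankZero.bsdp_iff_kobayashiLowerDivisibility
    (h12 : thm12_signedSelmerDual_finite_torsion) (h41 : thm41_signedCharIdeal_divisibility)
    (hKim : BDKim2013.cor315_signedCharValue_rankZero)
    (h5 : realPeriodRat_eq_unit_mul_plusPeriod) (h3 : realPeriodRat_eq_unit_mul_plusPeriod_three)
    (hmodP : nonempty_modularParametrizationData) (hmod : hasEntireLFunction_rat)
    (hGZK : rank_eq_analyticRank_of_analyticRank_le_one)
    (hp : p ≠ 2) (hX : ClassX6 W p) (h0 : W.analyticRank = 0) (ε : ℤˣ) :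
    BSDp W p ↔ KobayashiLowerDivisibility W p ε :=
  ⟨fun hB ↦ kobayashiLowerDivisibility_of_mainConjecture
      (X6RankZero.kobayashiMainConjecture_of_inputs_of_bsdp W p h12 h41 hKim h5 h3 hmod hGZK hp hX h0 hB ε),
    fun hε ↦ X6RankZero.bsdp_of_inputs_of_kobayashiLowerDivisibility W p h12 h41 hKim h5 h3 hmodP hmod hGZK
      hp hX h0 hε⟩

/-- **X6 ∧ {r_an = 0}, odd `p`: at a rank-zero pair the Eisenstein half IS the whole main conjecture** (same
sign), over the eight inputs — the Kato-side half being Kobayashi Thm. 4.1. Per pair; closes nothing.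
[cite: Kobayashi2003, Thm. 4.1 (p. 8) and Conjecture (p. 2)] [cite: BDKim2013, Cor. 3.15 (p. 199)] -/
theorem X6RankZero.kobayashiLowerDivisibility_iff_mainConjecture
    (h12 : thm12_signedSelmerDual_finite_torsion) (h41 : thm41_signedCharIdeal_divisibility)
    (hKim : BDKim2013.cor315_signedCharValue_rankZero)
    (h5 : realPeriodRat_eq_unit_mul_plusPeriod) (h3 : realPeriodRat_eq_unit_mul_plusPeriod_three)
    (hmodP : nonempty_modularParametrizationData) (hmod : hasEntireLFunction_rat)
    (hGZK : rank_eq_analyticRank_of_analyticRank_le_one)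
    (hp : p ≠ 2) (hX : ClassX6 W p) (h0 : W.analyticRank = 0) (ε : ℤˣ) :
    KobayashiLowerDivisibility W p ε ↔ KobayashiMainConjecture W p ε :=
  ⟨fun hε ↦ X6RankZero.kobayashiMainConjecture_of_inputs_of_bsdp W p h12 h41 hKim h5 h3 hmod hGZK hp hX h0
      (X6RankZero.bsdp_of_inputs_of_kobayashiLowerDivisibility W p h12 h41 hKim h5 h3 hmodP hmod hGZK hp hX h0
        hε) ε,
    kobayashiLowerDivisibility_of_mainConjecture⟩

/-- **Sign change at a rank-zero X6 pair**: the Eisenstein half for one sign gives it (indeed the full main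
conjecture) for the other, over the eight inputs (through `BSD(E,p)`). Per pair; closes nothing.
[cite: Kobayashi2003, Thm. 4.1 (p. 8) and Conjecture (p. 2)] [cite: BDKim2013, Cor. 3.15 (p. 199)] -/
theorem X6RankZero.kobayashiMainConjecture_of_inputs_of_kobayashiLowerDivisibility
    (h12 : thm12_signedSelmerDual_finite_torsion) (h41 : thm41_signedCharIdeal_divisibility)
    (hKim : BDKim2013.cor315_signedCharValue_rankZero)
    (h5 : realPeriodRat_eq_unit_mul_plusPeriod) (h3 : realPeriodRat_eq_unit_mul_plusPeriod_three)
    (hmodP : nonempty_modularParametrizationData) (hmod : hasEntireLFunction_rat)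
    (hGZK : rank_eq_analyticRank_of_analyticRank_le_one)
    (hp : p ≠ 2) (hX : ClassX6 W p) (h0 : W.analyticRank = 0) {ε : ℤˣ}
    (hε : KobayashiLowerDivisibility W p ε) (ε' : ℤˣ) : KobayashiMainConjecture W p ε' :=
  X6RankZero.kobayashiMainConjecture_of_inputs_of_bsdp W p h12 h41 hKim h5 h3 hmod hGZK hp hX h0
    (X6RankZero.bsdp_of_inputs_of_kobayashiLowerDivisibility W p h12 h41 hKim h5 h3 hmodP hmod hGZK hp hX h0 hε) ε'

end Pair

/-! ### §2 Class level: the rung `WAllCornerX6r0` ⟺ Kobayashi's main conjecture on the rank-zero slice of X6 -/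

section Classwide

/-- **The rung from the eight inputs and a one-sign Kobayashi lower divisibility at every X6 ∧ {r_an = 0} pair
with odd `p`** (the `r_an = 0` restriction of the body of K3's crux `KobayashiLowerHalfSemistable`, stmt-19000):
pair by pair `X6RankZero.bsdp_of_inputs_of_kobayashiLowerDivisibility`; CM binder discharged by the adapter
`X6RankZero.wallCornerX6r0_of_forall`. CONDITIONAL on `h`; closes nothing.
[cite: Kobayashi2003, Thm. 1.2 (p. 2), Thm. 4.1 (p. 8) and Conjecture (p. 2)] [cite: BDKim2013, Cor. 3.15 (p. 199)]
[cite: Miller2011LMS, §1 and Def. 1.1] -/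
theorem X6RankZero.wallCornerX6r0_of_inputs_of_forall_kobayashiLowerDivisibility_rankZero
    (h12 : thm12_signedSelmerDual_finite_torsion) (h41 : thm41_signedCharIdeal_divisibility)
    (hKim : BDKim2013.cor315_signedCharValue_rankZero)
    (h5 : realPeriodRat_eq_unit_mul_plusPeriod) (h3 : realPeriodRat_eq_unit_mul_plusPeriod_three)
    (hmodP : nonempty_modularParametrizationData) (hmod : hasEntireLFunction_rat)
    (hGZK : rank_eq_analyticRank_of_analyticRank_le_one)
    (h : ∀ (W : WeierstrassCurve ℚ) [W.IsElliptic] [W.IsGloballyMinimal] (p : ℕ) [Fact p.Prime],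
      p ≠ 2 → ClassX6 W p → W.analyticRank = 0 → ∃ ε : ℤˣ, KobayashiLowerDivisibility W p ε) :
    WAllCornerX6r0 :=
  X6RankZero.wallCornerX6r0_of_forall fun W _ _ p _ hp hX h0 ↦ by
    obtain ⟨ε, hε⟩ := h W p hp hX h0
    exact X6RankZero.bsdp_of_inputs_of_kobayashiLowerDivisibility W p h12 h41 hKim h5 h3 hmodP hmod hGZK hp hX
      h0 hε

/-- **«Route PrintX6 is mooted if SignedLowerHalves closes KobayashiLowerHalfSemistable», Wuthrich-free, over the
eight inputs**: the BODY of K3's crux 19000 (`∀ W p, p ≠ 2 → ClassX6 W p → ∃ ε, KobayashiLowerDivisibility W p ε`,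
rank-free; cell bsd-ssimc, route `SignedLowerHalves`) ⟹ the rung. Compare tranche 2's
`X6RankZero.wallCornerX6r0_of_forall_kobayashiLowerDivisibility` (Wuthrich Prop. 21 road) and
`…_of_upper_of_forall_kobayashiLowerDivisibility` (upper half as a hypothesis): here the upper half is the proved
one. The by-name version consuming the item's `def` is a one-liner over this theorem (Theorems side).
CONDITIONAL on `h`; closes nothing. [cite: Kobayashi2003, Thm. 1.2 (p. 2), Thm. 4.1 (p. 8) and Conjecture (p. 2)]
[cite: BDKim2013, Cor. 3.15 (p. 199)] [cite: Miller2011LMS, §1 and Def. 1.1] -/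
theorem X6RankZero.wallCornerX6r0_of_inputs_of_forall_kobayashiLowerDivisibility
    (h12 : thm12_signedSelmerDual_finite_torsion) (h41 : thm41_signedCharIdeal_divisibility)
    (hKim : BDKim2013.cor315_signedCharValue_rankZero)
    (h5 : realPeriodRat_eq_unit_mul_plusPeriod) (h3 : realPeriodRat_eq_unit_mul_plusPeriod_three)
    (hmodP : nonempty_modularParametrizationData) (hmod : hasEntireLFunction_rat)
    (hGZK : rank_eq_analyticRank_of_analyticRank_le_one)
    (h : ∀ (W : WeierstrassCurve ℚ) [W.IsElliptic] [W.IsGloballyMinimal] (p : ℕ) [Fact p.Prime],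
      p ≠ 2 → ClassX6 W p → ∃ ε : ℤˣ, KobayashiLowerDivisibility W p ε) :
    WAllCornerX6r0 :=
  X6RankZero.wallCornerX6r0_of_inputs_of_forall_kobayashiLowerDivisibility_rankZero h12 h41 hKim h5 h3 hmodP hmod
    hGZK fun W _ _ p _ hp hX _ ↦ h W p hp hX

/-- **Rung ⟹ Kobayashi's ± main conjecture, BOTH signs, at every X6 ∧ {r_an = 0} pair with odd `p`**, over the
inputs (`h12`, `h41`, `hKim`, `h5`, `h3`, `hmod`, `hGZK`): the rung gives `BSD(E,p)` at the pair
(`X6RankZero.forall_of_wallCornerX6r0`, CM binder by `ClassX6.not_hasCM`) and the rank-zero converse turns it into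
the main conjecture for each sign. CONDITIONAL on the rung (OPEN); closes nothing.
[cite: Kobayashi2003, Thm. 1.2 (p. 2), Thm. 4.1 (p. 8), (3.6) (p. 7) and Conjecture (p. 2)] [cite: BDKim2013, Cor. 3.15 (p. 199)]
[cite: GreenbergVatsal2000, §3, Remark 3.4] [cite: Miller2011LMS, Def. 1.1] [cite: SilvermanATAEC1994, Thm. II.6.4 (PDF p. 148)] -/
theorem X6RankZero.forall_kobayashiMainConjecture_of_wallCornerX6r0
    (h12 : thm12_signedSelmerDual_finite_torsion) (h41 : thm41_signedCharIdeal_divisibility)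
    (hKim : BDKim2013.cor315_signedCharValue_rankZero)
    (h5 : realPeriodRat_eq_unit_mul_plusPeriod) (h3 : realPeriodRat_eq_unit_mul_plusPeriod_three)
    (hmod : hasEntireLFunction_rat) (hGZK : rank_eq_analyticRank_of_analyticRank_le_one)
    (h : WAllCornerX6r0) :
    ∀ (W : WeierstrassCurve ℚ) [W.IsElliptic] [W.IsGloballyMinimal] (p : ℕ) [Fact p.Prime],
      p ≠ 2 → ClassX6 W p → W.analyticRank = 0 → ∀ ε : ℤˣ, KobayashiMainConjecture W p ε :=
  fun W _ _ p _ hp hX h0 ε ↦ X6RankZero.kobayashiMainConjecture_of_inputs_of_bsdp W p h12 h41 hKim h5 h3 hmod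
    hGZK hp hX h0 (X6RankZero.forall_of_wallCornerX6r0 h W p hp hX h0) ε

/-- **Over the eight refereed inputs, the rung W-ALL/6 IS Kobayashi's ± main conjecture (both signs) on the
rank-zero slice of X6.** `→` rank-zero converse; `←` one sign's Eisenstein half already suffices. A statement
about hypotheses, not a theorem about curves; closes nothing.
[cite: Kobayashi2003, Thm. 1.2 (p. 2), Thm. 4.1 (p. 8) and Conjecture (p. 2)] [cite: BDKim2013, Cor. 3.15 (p. 199)]
[cite: Miller2011LMS, §1 and Def. 1.1] -/
theorem X6RankZero.wallCornerX6r0_iff_forall_kobayashiMainConjecture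
    (h12 : thm12_signedSelmerDual_finite_torsion) (h41 : thm41_signedCharIdeal_divisibility)
    (hKim : BDKim2013.cor315_signedCharValue_rankZero)
    (h5 : realPeriodRat_eq_unit_mul_plusPeriod) (h3 : realPeriodRat_eq_unit_mul_plusPeriod_three)
    (hmodP : nonempty_modularParametrizationData) (hmod : hasEntireLFunction_rat)
    (hGZK : rank_eq_analyticRank_of_analyticRank_le_one) :
    WAllCornerX6r0 ↔
      ∀ (W : WeierstrassCurve ℚ) [W.IsElliptic] [W.IsGloballyMinimal] (p : ℕ) [Fact p.Prime],
        p ≠ 2 → ClassX6 W p → W.analyticRank = 0 → ∀ ε : ℤˣ, KobayashiMainConjecture W p ε :=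
  ⟨X6RankZero.forall_kobayashiMainConjecture_of_wallCornerX6r0 h12 h41 hKim h5 h3 hmod hGZK,
    fun h ↦ X6RankZero.wallCornerX6r0_of_inputs_of_forall_kobayashiLowerDivisibility_rankZero h12 h41 hKim h5 h3
      hmodP hmod hGZK fun W _ _ p _ hp hX h0 ↦ ⟨1, kobayashiLowerDivisibility_of_mainConjecture (h W p hp hX h0 1)⟩⟩

/-- **Over the eight refereed inputs, the rung W-ALL/6 IS the one-sign Eisenstein half on the rank-zero slice of
X6** — the `r_an = 0` restriction of the body of K3's crux `KobayashiLowerHalfSemistable` (stmt-19000). Together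
with `X6RankZero.wallCornerX6r0_iff_forall_kobayashiMainConjecture`: on that slice the weakest form (∃ sign,
Eisenstein half) and the strongest (∀ sign, full main conjecture) are equivalent. Closes nothing.
[cite: Kobayashi2003, Thm. 1.2 (p. 2), Thm. 4.1 (p. 8) and Conjecture (p. 2)] [cite: BDKim2013, Cor. 3.15 (p. 199)]
[cite: Miller2011LMS, §1 and Def. 1.1] -/
theorem X6RankZero.wallCornerX6r0_iff_forall_exists_kobayashiLowerDivisibility
    (h12 : thm12_signedSelmerDual_finite_torsion) (h41 : thm41_signedCharIdeal_divisibility)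
    (hKim : BDKim2013.cor315_signedCharValue_rankZero)
    (h5 : realPeriodRat_eq_unit_mul_plusPeriod) (h3 : realPeriodRat_eq_unit_mul_plusPeriod_three)
    (hmodP : nonempty_modularParametrizationData) (hmod : hasEntireLFunction_rat)
    (hGZK : rank_eq_analyticRank_of_analyticRank_le_one) :
    WAllCornerX6r0 ↔
      ∀ (W : WeierstrassCurve ℚ) [W.IsElliptic] [W.IsGloballyMinimal] (p : ℕ) [Fact p.Prime],
        p ≠ 2 → ClassX6 W p → W.analyticRank = 0 → ∃ ε : ℤˣ, KobayashiLowerDivisibility W p ε :=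
  ⟨fun h W _ _ p _ hp hX h0 ↦ ⟨1, kobayashiLowerDivisibility_of_mainConjecture
      (X6RankZero.forall_kobayashiMainConjecture_of_wallCornerX6r0 h12 h41 hKim h5 h3 hmod hGZK h W p hp hX h0 1)⟩,
    X6RankZero.wallCornerX6r0_of_inputs_of_forall_kobayashiLowerDivisibility_rankZero h12 h41 hKim h5 h3 hmodP
      hmod hGZK⟩

end Classwide

end Summit.BirchSwinnertonDyer.Rank1Residual.Supersingular

end
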